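import Summits.KontsevichZagierPeriods.KontsevichZagierPeriods.Theorems.IsogenyCertificatesXMapPeriodTransferCellsBasic
import Summits.KontsevichZagierPeriods.KontsevichZagierPeriods.Theorems.IsogenyCertificatesAlgebraicModuliRealPeriodCellPeriodRep
import Literature.NumberTheory.Transcendental.KZLogCalculusProofs
import Literature.NumberTheory.Transcendental.KZSemiCanonicalReductionProofs

/-!
# `AlgebraicModuliRealPeriodCell` (stmt-KontsevichZagierPeriods-18265), line `Sketch` — stub T
(`stub_algXMapTransfer`), the CENSUS step with real-algebraic scalars

Port of the ℚ-line's `XMapPeriodTransferCells.stub_cellCensus`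
(Theorems/IsogenyCertificatesXMapPeriodTransferStubCellCensus.lean) from rational scalars to scalars in
the field `K = algebraicClosure ℚ ℝ` of real algebraic numbers. For a saturated source piece
`K₀ ⊆ {P > 0}` (a union of cells of the cell locus `L = {P > 0, W ≠ 0}` up to the finite set
`{W = 0}`), all of whose cells are mapped by the real x-map `R` injectively onto the unbounded component
`U'` of `{P' > 0}` or onto the egg `E'`, and for which the rule-(2) move
`[cell, a/√P] ≡ [R(cell), (a κ)/√P']` is available for every scalar `a ∈ K` (hypothesis; `κ ∈ K`
plays the rôle of `1/|c|`), one has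

  `[K₀, a/√P] ≡ [U', (m_U a κ)/√P'] + [E', (m_E a κ)/√P']`  (mod `KZ.relations`),

where `m_U`, `m_E` count the cells of `K₀` landing on `U'`, resp. `E'`. Purely formal bookkeeping
(finite domain additivity `KZ.of_sub_sum_of_mem_relations`, per-cell moves, regrouping, merging copies by
integrand additivity); the semialgebraicity of the `ℝ¹`-trace of `L` is a HYPOTHESIS here (supplied by the
cells-basic file of the line), that of the target pieces comes from the foundation
(`PeriodRep.isSemialgebraic_domain`, real algebraic `α', β'`). The generic inputs
(`isSemialgebraic_hat_connectedComponentIn`, `finite_setOf_connectedComponentIn`,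
`volume_hat_eq_zero_of_finite`) are the ℚ-line's, imported.

References: M. Kontsevich, D. Zagier, *Periods* (2001), §1.2 (rules (1), (2)); S. Basu, R. Pollack,
M.-F. Roy, *Algorithms in Real Algebraic Geometry* (2006), Thm. 5.22.
-/

noncomputable section

open Set Filter MeasureTheory Polynomial Topology
open Literature.NumberTheory.Transcendental
open Literature.ModelTheory.ExponentialFields (IsSemialgebraic)
open Summit.KontsevichZagierPeriods.IsogenyCertificates.XMapPeriodTransferCells
  (isSemialgebraic_hat_connectedComponentIn finite_setOf_connectedComponentIn volume_hat_eq_zero_of_finite)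

namespace Summit.KontsevichZagierPeriods.IsogenyCertificates.AlgRealPeriodCell.TransferCellCensus

/-! ### Formal bookkeeping in `KZ.FormalRep` -/

/-- Merging copies by integrand additivity, real-algebraic scalars: for a family of representations
`T q = [D, q/ψ]` (`q ∈ ℚ̄ ∩ ℝ`) on a common domain, `m • [T q] − [T (m q)] ∈ KZ.relations` for every
`m : ℕ`. [cite: KontsevichZagier2001, §1.2 rule (1)] -/
theorem cellCensus_merge {n : ℕ} {D : Set (Fin n → ℝ)} {ψ : (Fin n → ℝ) → ℝ}
    (T : ↥(algebraicClosure ℚ ℝ) → KZ.IntegralRep n) (hTd : ∀ q, (T q).domain = D)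
    (hTi : ∀ q, (T q).integrand = fun x => (q : ℝ) / ψ x) (q : ↥(algebraicClosure ℚ ℝ)) :
    ∀ m : ℕ, m • KZ.of (T q) - KZ.of (T (m * q)) ∈ KZ.relations
  | 0 => by
      have h : KZ.of (T (((0 : ℕ) : ↥(algebraicClosure ℚ ℝ)) * q)) ∈ KZ.relations :=
        KZ.of_mem_relations_of_eqOn_zero _ fun x _ => by simp [hTi]
      simpa using KZ.relations.neg_mem h
  | m + 1 => by
      have ih := cellCensus_merge T hTd hTi q m
      have hadd : KZ.of (T ((m + 1 : ℕ) * q)) - KZ.of (T (m * q)) - KZ.of (T q) ∈ KZ.relations :=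
        KZ.integrandAddRel_subset_relations ⟨n, T _, T _, T _, by rw [hTd, hTd], by rw [hTd, hTd],
          fun x _ => by simp only [hTi, Pi.add_apply]; push_cast; ring, rfl⟩
      have : (m + 1) • KZ.of (T q) - KZ.of (T ((m + 1 : ℕ) * q)) =
          (m • KZ.of (T q) - KZ.of (T (m * q))) -
            (KZ.of (T ((m + 1 : ℕ) * q)) - KZ.of (T (m * q)) - KZ.of (T q)) := by
        rw [succ_nsmul]; abel
      rw [this]
      exact KZ.relations.sub_mem ih hadd

/-- The representations `[D, s/√P]` (`s ∈ ℚ̄ ∩ ℝ`) on a `ℚ`-semialgebraic `D ⊆ {P > 0}`, `P = x³+αx+β`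
with real algebraic `α, β`, integrability being inherited from that of `dx/√P` on `{P > 0}`.
[cite: KontsevichZagier2001, §1.1] -/
theorem cellCensus_exists_rep {α β : ℝ} (hα : IsAlgebraic ℚ α) (hβ : IsAlgebraic ℚ β)
    {D : Set (Fin 1 → ℝ)} (hD : IsSemialgebraic ℚ D)
    (hDS : D ⊆ {x : Fin 1 → ℝ | 0 < x 0 ^ 3 + α * x 0 + β})
    (hint : IntegrableOn (fun x : Fin 1 → ℝ => 1 / Real.sqrt (x 0 ^ 3 + α * x 0 + β))
      {x : Fin 1 → ℝ | 0 < x 0 ^ 3 + α * x 0 + β}) :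
    ∃ T : ↥(algebraicClosure ℚ ℝ) → KZ.IntegralRep 1, (∀ s, (T s).domain = D) ∧
      ∀ s, (T s).integrand = fun x => (s : ℝ) / Real.sqrt (x 0 ^ 3 + α * x 0 + β) := by
  have hmeas : MeasurableSet D := IsSemialgebraic.measurableSet_holds hD
  refine ⟨fun s => ⟨D, fun x => (s : ℝ) / Real.sqrt (x 0 ^ 3 + α * x 0 + β), hD,
    (PeriodRep.isSemialgebraicFunOn_integrand hα hβ (mem_algebraicClosure_iff.1 s.2)).mono hDS hD, ?_⟩,
    fun _ => rfl, fun _ => rfl⟩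
  have h1 : IntegrableOn
      (fun x : Fin 1 → ℝ => (s : ℝ) * (1 / Real.sqrt (x 0 ^ 3 + α * x 0 + β))) D :=
    (hint.mono_set hDS).const_mul (s : ℝ)
  exact h1.congr_fun (fun x _ => by ring) hmeas

/-- **The census with real-algebraic scalars** (finite domain additivity + grouping + integrand
merges). For a saturated source piece `K ⊆ {P > 0}` all of whose cells are mapped injectively onto `U'`
or the egg `E'` and moved by rule (2) with the scalar factor `κ ∈ ℚ̄ ∩ ℝ`:
`[K, a/√P] ≡ [U', (m_U a κ)/√P'] + [E', (m_E a κ)/√P']`, with `m_E = 0` when every cell lands on `U'`.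
[cite: KontsevichZagier2001, §1.2 rules (1), (2)] -/
theorem cellCensus : ∀ (α β α' β' : ℝ), IsAlgebraic ℚ α' → IsAlgebraic ℚ β' → ∀ (f g : Polynomial ℝ), Polynomial.derivative f * g - f * Polynomial.derivative g ≠ 0 → ∀ (R W : ℝ → ℝ) (L : Set ℝ), R = (fun y => f.eval y / g.eval y) → W = (fun y => (Polynomial.derivative f * g - f * Polynomial.derivative g).eval y) → L = {y : ℝ | 0 < y ^ 3 + α * y + β ∧ W y ≠ 0} → Literature.ModelTheory.ExponentialFields.IsSemialgebraic ℚ {x : Fin 1 → ℝ | x 0 ∈ L} → ∀ (U' E' : Set ℝ), U' = connectedComponentIn {y : ℝ | 0 < y ^ 3 + α' * y + β'} (1 + |α'| + |β'|) → E' = {y : ℝ | 0 < y ^ 3 + α' * y + β'} \ U' → ∀ (K : Set ℝ), K ⊆ {y : ℝ | 0 < y ^ 3 + α * y + β} → Literature.ModelTheory.ExponentialFields.IsSemialgebraic ℚ {x : Fin 1 → ℝ | x 0 ∈ K} → (∀ x₀ ∈ L, x₀ ∈ K → connectedComponentIn L x₀ ⊆ K) → (∀ x₀ ∈ L, x₀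 ∈ K → Set.InjOn R (connectedComponentIn L x₀) ∧ (R '' connectedComponentIn L x₀ = U' ∨ R '' connectedComponentIn L x₀ = E')) → ∀ (κ : ↥(algebraicClosure ℚ ℝ)), (∀ x₀ ∈ L, x₀ ∈ K → ∀ (a : ↥(algebraicClosure ℚ ℝ)) (rI t : Literature.NumberTheory.Transcendental.KZ.IntegralRep 1), rI.domain = {x | x 0 ∈ connectedComponentIn L x₀} → Set.EqOn rI.integrand (fun x => (a : ℝ) / Real.sqrt (x 0 ^ 3 + α * x 0 + β)) rI.domain → t.domain = {x | x 0 ∈ R '' connectedComponentIn L x₀} → Set.EqOn t.integrand (fun x => ((a * κ : ↥(algebraicClosure ℚ ℝ)) : ℝ) / Real.sqrt (x 0 ^ 3 + α' * x 0 + β')) t.domain → Literature.NumberTheory.Transcendental.KZ.of rI - Literature.NumberTheory.Transcendental.KZ.of t ∈ Literature.NumberTheory.Transcendental.KZ.relations) → MeasureTheory.IntegrableOn (fun x : Fin 1 → ℝ => 1 / Real.sqrt (x 0 ^ 3 + α' * x 0 + β')) {x : Fin 1 → ℝ | 0 < x 0 ^ 3 + α' * x 0 + β'} → ∃ mU mE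 : ℕ, ((∀ x₀ ∈ L, x₀ ∈ K → R '' connectedComponentIn L x₀ = U') → mE = 0) ∧ ∀ (a : ↥(algebraicClosure ℚ ℝ)) (ρ : Literature.NumberTheory.Transcendental.KZ.IntegralRep 1), ρ.domain = {x | x 0 ∈ K} → Set.EqOn ρ.integrand (fun x => (a : ℝ) / Real.sqrt (x 0 ^ 3 + α * x 0 + β)) ρ.domain → ∃ u e : Literature.NumberTheory.Transcendental.KZ.IntegralRep 1, u.domain = {x | x 0 ∈ U'} ∧ Set.EqOn u.integrand (fun x => (((mU : ↥(algebraicClosure ℚ ℝ)) * (a * κ) : ↥(algebraicClosure ℚ ℝ)) : ℝ) / Real.sqrt (x 0 ^ 3 + α' * x 0 + β')) u.domain ∧ e.domain = {x | x 0 ∈ E'} ∧ Set.EqOn e.integrand (fun x => (((mE : ↥(algebraicClosure ℚ ℝ)) * (a * κ) : ↥(algebraicClosure ℚ ℝ)) : ℝ) / Real.sqrt (x 0 ^ 3 + α' * x 0 + β')) e.domain ∧ Literature.NumberTheory.Transcendental.KZ.of ρ - Literature.NumberTheory.Transcendental.KZ.of u - Literature.NumberTheory.Transcendental.KZ.of e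 ∈ Literature.NumberTheory.Transcendental.KZ.relations := by
  intro α β α' β' hα' hβ' f g hW R W L _ hWd hL hLsa U' E' hU' hE' K hK _ hsat himg κ hmove hint
  classical
  -- the zero set of the Wronskian is finite
  have hZfin : {y : ℝ | W y = 0}.Finite := by
    refine ((derivative f * g - f * derivative g).roots).toFinset.finite_toSet.subset fun y hy => ?_
    have hy' : (derivative f * g - f * derivative g).eval y = 0 := by simpa [hWd] using hy
    exact Finset.mem_coe.mpr (Multiset.mem_toFinset.mpr ((Polynomial.mem_roots hW).mpr hy'))
  -- the cells of `K`: a finite set of connected components of `L`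
  have h𝒞₀fin : {C : Set ℝ | ∃ y ∈ L, y ∈ K ∧ C = connectedComponentIn L y}.Finite :=
    (finite_setOf_connectedComponentIn hLsa).subset fun C ⟨y, hyL, _, hC⟩ => ⟨y, hyL, hC⟩
  obtain ⟨𝒞, h𝒞⟩ : ∃ 𝒞 : Finset (Set ℝ), ∀ C, C ∈ 𝒞 ↔ ∃ y ∈ L, y ∈ K ∧ C = connectedComponentIn L y :=
    ⟨h𝒞₀fin.toFinset, fun C => h𝒞₀fin.mem_toFinset⟩
  have hspec : ∀ i : ↥𝒞, ∃ y ∈ L, y ∈ K ∧ (i : Set ℝ) = connectedComponentIn L y := fun i =>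
    (h𝒞 _).mp i.2
  have hsa : ∀ i : ↥𝒞, IsSemialgebraic ℚ {x : Fin 1 → ℝ | x 0 ∈ (i : Set ℝ)} := fun i => by
    obtain ⟨y, -, -, h⟩ := hspec i
    rw [h]; exact isSemialgebraic_hat_connectedComponentIn hLsa y
  have hsubK : ∀ i : ↥𝒞, (i : Set ℝ) ⊆ K := fun i => by
    obtain ⟨y, hyL, hyK, h⟩ := hspec i
    rw [h]; exact hsat y hyL hyK
  -- the target families `[Û', s/√P']`, `[Ê', s/√P']`
  have hU'sub : {x : Fin 1 → ℝ | x 0 ∈ U'} ⊆ {x | 0 < x 0 ^ 3 + α' * x 0 + β'} := by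
    intro x hx
    have hx' : x 0 ∈ U' := hx
    rw [hU'] at hx'
    have h := connectedComponentIn_subset _ _ hx'
    exact h
  have hE'sub : {x : Fin 1 → ℝ | x 0 ∈ E'} ⊆ {x | 0 < x 0 ^ 3 + α' * x 0 + β'} := by
    intro x hx
    have hx' : x 0 ∈ E' := hx
    rw [hE'] at hx'
    have h := hx'.1
    exact h
  have hPsa : IsSemialgebraic ℚ {x : Fin 1 → ℝ | x 0 ∈ {y : ℝ | 0 < y ^ 3 + α' * y + β'}} :=
    PeriodRep.isSemialgebraic_domain hα' hβ'
  have hU'sa : IsSemialgebraic ℚ {x : Fin 1 → ℝ | x 0 ∈ U'} := by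
    rw [hU']; exact isSemialgebraic_hat_connectedComponentIn hPsa _
  have hE'sa : IsSemialgebraic ℚ {x : Fin 1 → ℝ | x 0 ∈ E'} := by
    rw [hE']; exact hPsa.diff hU'sa
  obtain ⟨TU, hTUd, hTUi⟩ := cellCensus_exists_rep hα' hβ' hU'sa hU'sub hint
  obtain ⟨TE, hTEd, hTEi⟩ := cellCensus_exists_rep hα' hβ' hE'sa hE'sub hint
  -- the counts
  obtain ⟨mU, hmU⟩ : ∃ m : ℕ, (𝒞.attach.filter fun i : ↥𝒞 => R '' i.1 = U').card = m := ⟨_, rfl⟩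
  obtain ⟨mE, hmE⟩ : ∃ m : ℕ, (𝒞.attach.filter fun i : ↥𝒞 => ¬ R '' i.1 = U').card = m :=
    ⟨_, rfl⟩
  refine ⟨mU, mE, fun hall => ?_, fun a ρ hρd hρe => ?_⟩
  · rw [← hmE, Finset.card_eq_zero, Finset.filter_eq_empty_iff]
    intro i _ h
    obtain ⟨y, hyL, hyK, hC⟩ := hspec i
    exact h (by rw [hC]; exact hall y hyL hyK)
  -- the cell pieces `ρ_ i = [Ĉᵢ, a/√P]`
  have hsub : ∀ i : ↥𝒞, {x : Fin 1 → ℝ | x 0 ∈ (i : Set ℝ)} ⊆ ρ.domain := fun i x hx => by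
    rw [hρd]; exact hsubK i hx
  obtain ⟨ρ_, hρ_d, hρ_i⟩ : ∃ ρ_ : ↥𝒞 → KZ.IntegralRep 1,
      (∀ i, (ρ_ i).domain = {x : Fin 1 → ℝ | x 0 ∈ (i : Set ℝ)}) ∧
        ∀ i, (ρ_ i).integrand = ρ.integrand :=
    ⟨fun i => ρ.restrict _ (hsa i) (hsub i), fun _ => rfl, fun _ => rfl⟩
  -- (a) `[ρ] − ∑ᵢ [ρ_ i] ∈ relations`: finite domain additivity
  have hcover : ρ.domain \ (⋃ i ∈ 𝒞.attach, (ρ_ i).domain) ⊆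
      {x : Fin 1 → ℝ | x 0 ∈ {y : ℝ | W y = 0}} := by
    rintro x ⟨hxK, hxU⟩
    rw [hρd] at hxK
    by_contra hWx
    have hxL : x 0 ∈ L := by rw [hL]; exact ⟨hK hxK, hWx⟩
    have hmem : connectedComponentIn L (x 0) ∈ 𝒞 := (h𝒞 _).mpr ⟨x 0, hxL, hxK, rfl⟩
    exact hxU (Set.mem_iUnion₂.mpr ⟨⟨_, hmem⟩, Finset.mem_attach _ _, by
      rw [hρ_d]; exact mem_connectedComponentIn hxL⟩)
  have hdisj : ∀ i j : ↥𝒞, i ≠ j → (ρ_ i).domain ∩ (ρ_ j).domain = ∅ := by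
    intro i j hij
    obtain ⟨y, -, -, hi⟩ := hspec i
    obtain ⟨y', -, -, hj⟩ := hspec j
    refine Set.eq_empty_of_forall_notMem fun x hx => hij (Subtype.ext ?_)
    rw [hρ_d, hρ_d] at hx
    have hx1 : x 0 ∈ connectedComponentIn L y := by rw [← hi]; exact hx.1
    have hx2 : x 0 ∈ connectedComponentIn L y' := by rw [← hj]; exact hx.2
    rw [hi, hj, connectedComponentIn_eq hx1, connectedComponentIn_eq hx2]
  have h1 : KZ.of ρ - ∑ i ∈ 𝒞.attach, KZ.of (ρ_ i) ∈ KZ.relations := by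
    refine KZ.of_sub_sum_of_mem_relations 𝒞.attach ρ ρ_ (fun i _ => ?_)
      (fun i _ x _ => by rw [hρ_i]) ?_ ?_
    · rw [hρ_d, Set.sdiff_eq_empty.mpr (hsub i), measure_empty]
    · exact measure_mono_null hcover (volume_hat_eq_zero_of_finite hZfin)
    · intro i _ j _ hij
      rw [hdisj i j hij, measure_empty]
  -- (b) the per-cell moves `[ρ_ i] − [t i] ∈ relations`
  obtain ⟨t, htU, htE⟩ : ∃ t : ↥𝒞 → KZ.IntegralRep 1,
      (∀ i : ↥𝒞, R '' i.1 = U' → t i = TU (a * κ)) ∧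
        ∀ i : ↥𝒞, ¬ R '' i.1 = U' → t i = TE (a * κ) :=
    ⟨fun i => if R '' i.1 = U' then TU (a * κ) else TE (a * κ), fun i h => if_pos h,
      fun i h => if_neg h⟩
  have h2 : ∑ i ∈ 𝒞.attach, KZ.of (ρ_ i) - ∑ i ∈ 𝒞.attach, KZ.of (t i) ∈ KZ.relations := by
    refine KZ.sum_sub_sum_mem_relations _ _ _ fun i _ => ?_
    obtain ⟨y, hyL, hyK, hC⟩ := hspec i
    obtain ⟨-, hUE⟩ := himg y hyL hyK
    refine hmove y hyL hyK a (ρ_ i) (t i) (by rw [hρ_d, hC]) (fun x hx => ?_) ?_ ?_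
    · rw [hρ_i]
      rw [hρ_d] at hx
      exact hρe (hsub i hx)
    · by_cases hU : R '' i.1 = U'
      · rw [htU i hU, hTUd, ← hC, hU]
      · rcases hUE with h | h
        · exact absurd (by rw [hC, h]) hU
        · rw [htE i hU, hTEd, h]
    · intro x _
      by_cases hU : R '' i.1 = U'
      · rw [htU i hU, hTUi]
      · rw [htE i hU, hTEi]
  -- (c) regrouping by target
  have hsum : ∑ i ∈ 𝒞.attach, KZ.of (t i) =
      mU • KZ.of (TU (a * κ)) + mE • KZ.of (TE (a * κ)) := by
    rw [← Finset.sum_filter_add_sum_filter_not 𝒞.attach (fun i : ↥𝒞 => R '' i.1 = U'),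
      Finset.sum_congr rfl fun i hi => by rw [htU i (Finset.mem_filter.mp hi).2], Finset.sum_const,
      Finset.sum_congr rfl fun i hi => by rw [htE i (Finset.mem_filter.mp hi).2], Finset.sum_const,
      hmU, hmE]
  -- (d) merging the copies
  have h3 := cellCensus_merge TU hTUd hTUi (a * κ) mU
  have h4 := cellCensus_merge TE hTEd hTEi (a * κ) mE
  refine ⟨TU (mU * (a * κ)), TE (mE * (a * κ)), hTUd _, fun x _ => by rw [hTUi], hTEd _,
    fun x _ => by rw [hTEi], ?_⟩
  have key := KZ.relations.add_mem (KZ.relations.add_mem (KZ.relations.add_mem h1 h2) h3) h4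
  rw [hsum] at key
  convert key using 1
  abel

end Summit.KontsevichZagierPeriods.IsogenyCertificates.AlgRealPeriodCell.TransferCellCensus

end
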